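import Mathlib.Algebra.Order.BigOperators.Ring.Finset
import Mathlib.Algebra.BigOperators.Ring.Finset
import Mathlib.Data.Finset.Powerset
import Mathlib.Analysis.SpecialFunctions.Pow.Real
import Mathlib.Tactic.Linarith
import Mathlib.Tactic.Ring
import Mathlib.Tactic.FieldSimp
import Mathlib.Tactic.GCongr
import Mathlib.Tactic.Positivity
import HarnessLib

/-!
# Run-weighted subset sums by a two-state transfer recursion (the engine behind Kumar–Saraf 2017,
Lemmas 9.2–9.4)

Topic `Literature/Computability/AlgebraicComplexity`; infrastructure for the printed proof of
`kumarSaraf2017_imm_homDepthFour` (`HomogeneousDepthFour.lean`), Step 5 of the roadmap in the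
provefact notes: the expected pair-correlation sums `E_V[∑_γ D^{-Δ(β,γ)}]` of [KS, Prop. 9.1,
Lemmas 9.2–9.4] over one block reduce (second moment over vertex walks) to sums over the set `A`
of layers on which two walks agree, weighted by `∏_{j ∈ A} w_j` (`w_j = D / deg_j`) and by a
factor `c = 1/ñ` for every maximal run of `A` that does not start at layer `0` (an "agree switch"
of [KS, Lemma 9.4]: two walks that have separated meet again only if two random rows pick a common
column). This file evaluates and bounds such sums abstractly:

* `runCost init A` — the number of runs of `A ⊆ ℕ` that are charged (`j ∈ A` with `j - 1 ∉ A`;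
  the run starting at `0` is charged iff `init = false`, i.e. iff the two walks start at different
  vertices); `runWeight w c init A = c ^ runCost init A * ∏_{j ∈ A} w j`.
* `aSeq, bSeq` — the transfer recursion `a_{j+1} = w_j (a_j + c b_j)`, `b_{j+1} = a_j + b_j`
  (`a` = mass of the sets containing the current last layer), from `(1, 0)` (`init = true`) or
  `(0, 1)` (`init = false`); **`sum_runWeight_eq`**: `∑_{A ⊆ [k]} runWeight A = a_k + b_k`.
* Bounds (real weights `w_j ≥ 0`, `c ≥ 0`; a "middle" phase `1 ≤ j < J` with `w_j ≤ 1 - δ` and a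
  "tail" `J ≤ j < J + L` with `w_j ≤ 2`, as for the degree profile `(d₁, 2, …, 2, 1, …, 1)` of
  [KS, §8.3] with `w_j = D/deg_j`, `D < 2`):
  `aSeq_le_middle` / `tSeq_le_middle` (geometric decay of the agreeing mass plus re-injection
  `c/δ`), `aSeq_le_tail` / `tSeq_tail_mul_le` / `tSeq_le_tail` (growth `≤ 2^L` in the tail),
  and the two packaged statements
  **`sum_runWeight_le_of_sameStart`** (`≤ 16 + κ`, [KS, Lemma 9.2/9.3]: `O(1)`) and
  **`sum_runWeight_le_of_diffStart`** (`≤ 1 + η` with `η` explicitly small, [KS, Lemma 9.4]: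
  `O(1/n)` beyond the empty set).

Everything is proved; the statements are parametric inequalities (no asymptotics inside).

## References

* M. Kumar, S. Saraf, *On the power of homogeneous depth 4 arithmetic circuits*, SIAM J. Comput.
  46 (2017) 336–387 (arXiv:1404.1950): Prop. 9.1, Lemmas 9.2, 9.3, 9.4, 9.5.
-/

namespace Literature.Computability.AlgebraicComplexity.KumarSaraf

open Finset

/-! ### Run weights and the transfer recursion -/

section Identity

variable {R : Type*} [CommSemiring R]

/-- The number of charged runs of `A ⊆ ℕ`: elements `j ∈ A` whose predecessor is not in `A`,
where the (virtual) predecessor of `0` counts as present iff `init` (same start vertex).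
[cite: KumarSaraf2017, Lemma 9.4] -/
def runCost (init : Bool) (A : Finset ℕ) : ℕ :=
  (A.filter fun j => ¬ (if j = 0 then init = true else j - 1 ∈ A)).card

/-- The weight `c^{#charged runs} ∏_{j ∈ A} w_j` of an agreement set. [cite: KumarSaraf2017, Lemma 9.2] -/
def runWeight (w : ℕ → R) (c : R) (init : Bool) (A : Finset ℕ) : R :=
  c ^ runCost init A * ∏ j ∈ A, w j

/-- The transfer recursion, agreeing mass: `a_{j+1} = w_j (a_j + c b_j)`. [cite: KumarSaraf2017, Lemma 9.2] -/
def aSeq (w : ℕ → R) (c : R) (init : Bool) : ℕ → R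
  | 0 => if init then 1 else 0
  | j + 1 => w j * (aSeq w c init j + c * bSeq w c init j)
where
  /-- The transfer recursion, non-agreeing mass: `b_{j+1} = a_j + b_j`. -/
  bSeq (w : ℕ → R) (c : R) (init : Bool) : ℕ → R
  | 0 => if init then 0 else 1
  | j + 1 => aSeq w c init j + bSeq w c init j

/-- Notation-friendly alias for the non-agreeing mass. [cite: KumarSaraf2017, Lemma 9.2] -/
abbrev bSeq (w : ℕ → R) (c : R) (init : Bool) : ℕ → R := aSeq.bSeq w c init

/-- Initial agreeing mass. [cite: KumarSaraf2017, Lemma 9.2] -/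
@[simp] theorem aSeq_zero (w : ℕ → R) (c : R) (init : Bool) :
    aSeq w c init 0 = if init then 1 else 0 := rfl

/-- Initial non-agreeing mass. [cite: KumarSaraf2017, Lemma 9.2] -/
@[simp] theorem bSeq_zero (w : ℕ → R) (c : R) (init : Bool) :
    bSeq w c init 0 = if init then 0 else 1 := rfl

/-- One step of the recursion, agreeing mass. [cite: KumarSaraf2017, Lemma 9.2] -/
theorem aSeq_succ (w : ℕ → R) (c : R) (init : Bool) (j : ℕ) :
    aSeq w c init (j + 1) = w j * (aSeq w c init j + c * bSeq w c init j) := rfl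

/-- One step of the recursion, non-agreeing mass. [cite: KumarSaraf2017, Lemma 9.2] -/
theorem bSeq_succ (w : ℕ → R) (c : R) (init : Bool) (j : ℕ) :
    bSeq w c init (j + 1) = aSeq w c init j + bSeq w c init j := rfl

/-- Adding a new maximum `k` to `A ⊆ [k]` charges one more run iff `k - 1 ∉ A` (for `k ≥ 1`) or
`init = false` (for `k = 0`). [cite: KumarSaraf2017, Lemma 9.4] -/
theorem runCost_insert (init : Bool) {k : ℕ} {A : Finset ℕ} (hA : A ⊆ range k) :
    runCost init (insert k A) =
      runCost init A + if (if k = 0 then init = true else k - 1 ∈ A) then 0 else 1 := by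
  have hk : k ∉ A := fun h => by simpa using hA h
  unfold runCost
  rw [filter_insert]
  -- the predicate on old elements is unchanged by inserting `k`
  have hsame : (A.filter fun j => ¬ (if j = 0 then init = true else j - 1 ∈ insert k A)) =
      A.filter fun j => ¬ (if j = 0 then init = true else j - 1 ∈ A) := by
    refine filter_congr fun j hj => ?_
    have hjk : j < k := by simpa using hA hj
    by_cases hj0 : j = 0
    · simp [hj0]
    · rw [if_neg hj0, if_neg hj0, mem_insert]
      have : j - 1 ≠ k := by omega
      simp [this]
  -- the predicate at `k` itself
  have hpk : (¬ (if k = 0 then init = true else k - 1 ∈ insert k A)) ↔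
      ¬ (if k = 0 then init = true else k - 1 ∈ A) := by
    by_cases hk0 : k = 0
    · simp [hk0]
    · rw [if_neg hk0, if_neg hk0, mem_insert]
      have : k - 1 ≠ k := by omega
      simp [this]
  by_cases hp : (if k = 0 then init = true else k - 1 ∈ A)
  · rw [if_neg (by rw [hpk]; exact not_not.2 hp), hsame, if_pos hp, add_zero]
  · rw [if_pos (by rw [hpk]; exact hp), hsame, if_neg hp,
      card_insert_of_notMem (fun h => hk (mem_filter.1 h).1)]

/-- The weight of `A ∪ {k}` for `A ⊆ [k]`. [cite: KumarSaraf2017, Lemma 9.2] -/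
theorem runWeight_insert (w : ℕ → R) (c : R) (init : Bool) {k : ℕ} {A : Finset ℕ}
    (hA : A ⊆ range k) :
    runWeight w c init (insert k A) =
      w k * (if (if k = 0 then init = true else k - 1 ∈ A) then 1 else c) * runWeight w c init A := by
  have hk : k ∉ A := fun h => by simpa using hA h
  unfold runWeight
  rw [runCost_insert init hA, prod_insert hk]
  split_ifs <;> ring

/-- The weight of `A ∪ {k}` when the run continues (`k - 1 ∈ A`, `k ≥ 1`).
[cite: KumarSaraf2017, Lemma 9.2] -/
theorem runWeight_insert_of_mem (w : ℕ → R) (c : R) (init : Bool) {k : ℕ} (hk : k ≠ 0)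
    {A : Finset ℕ} (hA : A ⊆ range k) (h : k - 1 ∈ A) :
    runWeight w c init (insert k A) = w k * runWeight w c init A := by
  rw [runWeight_insert w c init hA]
  simp [hk, h]

/-- The weight of `A ∪ {k}` when a new run starts (`k - 1 ∉ A`, `k ≥ 1`): one more charge `c`.
[cite: KumarSaraf2017, Lemma 9.4] -/
theorem runWeight_insert_of_not_mem (w : ℕ → R) (c : R) (init : Bool) {k : ℕ} (hk : k ≠ 0)
    {A : Finset ℕ} (hA : A ⊆ range k) (h : k - 1 ∉ A) :
    runWeight w c init (insert k A) = w k * c * runWeight w c init A := by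
  rw [runWeight_insert w c init hA]
  simp [hk, h]

/-- **The transfer identity, split form**: for `k ≥ 1`, `a_k` is the total weight of the
`A ⊆ [k]` containing `k - 1` and `b_k` that of those not containing it. [cite: KumarSaraf2017, Lemma 9.2] -/
theorem aSeq_bSeq_eq_sum (w : ℕ → R) (c : R) (init : Bool) (k : ℕ) (hk : 1 ≤ k) :
    aSeq w c init k = ∑ A ∈ (range k).powerset.filter (fun A => k - 1 ∈ A), runWeight w c init A ∧
    bSeq w c init k = ∑ A ∈ (range k).powerset.filter (fun A => k - 1 ∉ A), runWeight w c init A := by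
  induction k with
  | zero => omega
  | succ k ih =>
    -- subsets of `[k+1]`: those of `[k]`, and those plus `k`
    have hsplitA : (range (k + 1)).powerset.filter (fun A => k + 1 - 1 ∈ A) =
        ((range k).powerset).image (insert k) := by
      ext A
      simp only [Nat.add_sub_cancel, mem_filter, mem_powerset, mem_image]
      constructor
      · rintro ⟨hsub, hkA⟩
        refine ⟨A.erase k, ?_, insert_erase hkA⟩
        intro j hj
        rw [mem_erase] at hj
        have := hsub hj.2
        rw [mem_range] at this ⊢
        omega
      · rintro ⟨B, hB, rfl⟩
        refine ⟨?_, mem_insert_self _ _⟩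
        rw [insert_subset_iff]
        exact ⟨by simp, hB.trans (range_subset_range.2 (Nat.le_succ k))⟩
    have hsplitB : (range (k + 1)).powerset.filter (fun A => k + 1 - 1 ∉ A) = (range k).powerset := by
      ext A
      simp only [Nat.add_sub_cancel, mem_filter, mem_powerset]
      constructor
      · rintro ⟨hsub, hkA⟩ j hj
        have := hsub hj
        rw [mem_range] at this ⊢
        have : j ≠ k := fun h => hkA (h ▸ hj)
        omega
      · intro hsub
        exact ⟨hsub.trans (range_subset_range.2 (Nat.le_succ k)), fun h => by simpa using hsub h⟩
    have hinj : Set.InjOn (insert k) ((range k).powerset : Set (Finset ℕ)) := by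
      intro A hA B hB h
      rw [mem_coe, mem_powerset] at hA hB
      have hkA : k ∉ A := fun h' => by simpa using hA h'
      have hkB : k ∉ B := fun h' => by simpa using hB h'
      rw [← erase_insert hkA, h, erase_insert hkB]
    -- the total over `[k]` is `a_k + b_k` (also for `k = 0`)
    have htot : ∑ A ∈ (range k).powerset, runWeight w c init A = aSeq w c init k + bSeq w c init k := by
      rcases Nat.eq_zero_or_pos k with rfl | hkpos
      · simp [runWeight, runCost]
        split_ifs <;> simp
      · obtain ⟨h1, h2⟩ := ih hkpos
        rw [h1, h2, ← sum_filter_add_sum_filter_not _ (fun A => k - 1 ∈ A)]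
    refine ⟨?_, ?_⟩
    · rw [hsplitA, sum_image hinj, aSeq_succ]
      rcases Nat.eq_zero_or_pos k with rfl | hkpos
      · -- `k = 0`: the only subset is `∅`
        cases init <;> simp [runWeight, runCost, Finset.filter_singleton, mul_comm]
      · obtain ⟨h1, h2⟩ := ih hkpos
        have hk0 : ¬ (k = 0) := by omega
        rw [← sum_filter_add_sum_filter_not ((range k).powerset) (fun A => k - 1 ∈ A), h1, h2,
          mul_add, ← mul_assoc, mul_sum, mul_sum]
        congr 1
        · refine sum_congr rfl fun A hA => ?_
          rw [mem_filter, mem_powerset] at hA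
          rw [runWeight_insert_of_mem w c init hk0 hA.1 hA.2]
        · refine sum_congr rfl fun A hA => ?_
          rw [mem_filter, mem_powerset] at hA
          rw [runWeight_insert_of_not_mem w c init hk0 hA.1 hA.2]
    · rw [hsplitB, bSeq_succ, htot]

/-- **The transfer identity**: `∑_{A ⊆ [k]} c^{#charged runs(A)} ∏_{j∈A} w_j = a_k + b_k`.
[cite: KumarSaraf2017, Lemma 9.2] -/
theorem sum_runWeight_eq (w : ℕ → R) (c : R) (init : Bool) (k : ℕ) :
    ∑ A ∈ (range k).powerset, runWeight w c init A = aSeq w c init k + bSeq w c init k := by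
  rcases Nat.eq_zero_or_pos k with rfl | hk
  · simp [runWeight, runCost]
    split_ifs <;> simp
  · obtain ⟨h1, h2⟩ := aSeq_bSeq_eq_sum w c init k hk
    rw [h1, h2, ← sum_filter_add_sum_filter_not _ (fun A => k - 1 ∈ A)]

end Identity


/-! ### Bounds for real weights -/

section Bounds

variable (w : ℕ → ℝ) (c : ℝ) (init : Bool)

/-- The total mass `T_j = a_j + b_j`. [cite: KumarSaraf2017, Lemma 9.2] -/
def tSeq (j : ℕ) : ℝ := aSeq w c init j + bSeq w c init j

/-- `T_0 = 1`. [cite: KumarSaraf2017, Lemma 9.2] -/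
@[simp] theorem tSeq_zero : tSeq w c init 0 = 1 := by
  unfold tSeq; cases init <;> simp

/-- `T_{j+1} = T_j + a_{j+1}`. [cite: KumarSaraf2017, Lemma 9.2] -/
theorem tSeq_succ (j : ℕ) : tSeq w c init (j + 1) = tSeq w c init j + aSeq w c init (j + 1) := by
  unfold tSeq
  rw [bSeq_succ]
  ring

variable {w c}

/-- Non-negativity of the recursion. [folklore] -/
theorem aSeq_nonneg (hw : ∀ j, 0 ≤ w j) (hc : 0 ≤ c) :
    ∀ j, 0 ≤ aSeq w c init j ∧ 0 ≤ bSeq w c init j := by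
  intro j
  induction j with
  | zero => cases init <;> simp
  | succ j ih =>
    rw [aSeq_succ, bSeq_succ]
    exact ⟨mul_nonneg (hw j) (add_nonneg ih.1 (mul_nonneg hc ih.2)), add_nonneg ih.1 ih.2⟩

/-- `T` is non-decreasing. [folklore] -/
theorem tSeq_mono (hw : ∀ j, 0 ≤ w j) (hc : 0 ≤ c) : Monotone (tSeq w c init) :=
  monotone_nat_of_le_succ fun j => by
    rw [tSeq_succ]
    linarith [(aSeq_nonneg init hw hc (j + 1)).1]

/-- `T ≥ 1`. [folklore] -/
theorem one_le_tSeq (hw : ∀ j, 0 ≤ w j) (hc : 0 ≤ c) (j : ℕ) : 1 ≤ tSeq w c init j := by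
  have := tSeq_mono init hw hc (Nat.zero_le j)
  rwa [tSeq_zero] at this

/-- The basic step estimate `a_{j+1} ≤ w_j (a_j + c T_j)`. [folklore] -/
theorem aSeq_succ_le (hw : ∀ j, 0 ≤ w j) (hc : 0 ≤ c) (j : ℕ) :
    aSeq w c init (j + 1) ≤ w j * (aSeq w c init j + c * tSeq w c init j) := by
  rw [aSeq_succ]
  have hb : bSeq w c init j ≤ tSeq w c init j := by
    unfold tSeq; linarith [(aSeq_nonneg init hw hc j).1]
  exact mul_le_mul_of_nonneg_left (by nlinarith [mul_le_mul_of_nonneg_left hb hc]) (hw j)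

/-- **Middle phase** (layers `1 ≤ j < J` with `w_j ≤ 1 - δ`: two walks that agree keep agreeing
with weight `D/2 < 1`, cf. [KS, Lemma 9.3]): the agreeing mass decays geometrically from `a_1`, up
to the re-injection `(c/δ) T` from the non-agreeing mass. [cite: KumarSaraf2017, Lemma 9.3] -/
theorem aSeq_le_middle (hw : ∀ j, 0 ≤ w j) (hc : 0 ≤ c) {δ : ℝ} (hδ0 : 0 < δ) (hδ1 : δ ≤ 1)
    {J : ℕ} (hmid : ∀ j, 1 ≤ j → j < J → w j ≤ 1 - δ) :
    ∀ j, 1 ≤ j → j ≤ J →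
      aSeq w c init j ≤ aSeq w c init 1 * (1 - δ) ^ (j - 1) + c / δ * tSeq w c init j := by
  intro j hj hjJ
  induction j with
  | zero => omega
  | succ j ih =>
    have hcd : 0 ≤ c / δ := div_nonneg hc hδ0.le
    rcases Nat.eq_zero_or_pos j with rfl | hjpos
    · have h1 := one_le_tSeq init hw hc 1
      have h2 : 0 ≤ c / δ * tSeq w c init 1 := mul_nonneg hcd (by linarith)
      rw [zero_add, Nat.sub_self, pow_zero, mul_one]
      linarith
    · have ih' := ih hjpos (by omega)
      have hstep := aSeq_succ_le init hw hc j
      have hwj := hmid j hjpos (by omega)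
      have hT : tSeq w c init j ≤ tSeq w c init (j + 1) := tSeq_mono init hw hc (Nat.le_succ j)
      have hTpos : 0 ≤ tSeq w c init j := le_trans zero_le_one (one_le_tSeq init hw hc j)
      have ha1 : 0 ≤ aSeq w c init 1 := (aSeq_nonneg init hw hc 1).1
      have haj : 0 ≤ aSeq w c init j := (aSeq_nonneg init hw hc j).1
      have hpow : (1 - δ) ^ (j + 1 - 1) = (1 - δ) * (1 - δ) ^ (j - 1) := by
        rw [Nat.add_sub_cancel, ← pow_succ', Nat.sub_add_cancel hjpos]
      rw [hpow]
      have hδ' : (0 : ℝ) ≤ 1 - δ := by linarith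
      have hpj : 0 ≤ (1 - δ) ^ (j - 1) := pow_nonneg hδ' _
      -- `a_{j+1} ≤ (1-δ)(a_j + c T_j)`
      have h1 : aSeq w c init (j + 1) ≤ (1 - δ) * (aSeq w c init j + c * tSeq w c init j) :=
        hstep.trans (mul_le_mul_of_nonneg_right hwj (by positivity))
      -- `(1-δ)(c/δ + c) ≤ c/δ`
      have h2 : (1 - δ) * (c / δ + c) ≤ c / δ := by
        rw [show (1 - δ) * (c / δ + c) = c / δ - c * δ by field_simp; ring]
        nlinarith
      have h3 : (1 - δ) * (aSeq w c init j + c * tSeq w c init j) ≤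
          (1 - δ) * (aSeq w c init 1 * (1 - δ) ^ (j - 1) + c / δ * tSeq w c init j +
            c * tSeq w c init j) := mul_le_mul_of_nonneg_left (by linarith) hδ'
      have h4 : (1 - δ) * (c / δ + c) * tSeq w c init j ≤ c / δ * tSeq w c init j :=
        mul_le_mul_of_nonneg_right h2 hTpos
      have h5 : c / δ * tSeq w c init j ≤ c / δ * tSeq w c init (j + 1) :=
        mul_le_mul_of_nonneg_left hT hcd
      have e : (1 - δ) * (aSeq w c init 1 * (1 - δ) ^ (j - 1) + c / δ * tSeq w c init j +
            c * tSeq w c init j) = aSeq w c init 1 * ((1 - δ) * (1 - δ) ^ (j - 1)) +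
              (1 - δ) * (c / δ + c) * tSeq w c init j := by ring
      linarith

/-- **Middle phase, total**: with `2 c J ≤ δ`, `T_J ≤ 2 (1 + a_1/δ)`.
[cite: KumarSaraf2017, Lemma 9.3] -/
theorem tSeq_le_middle (hw : ∀ j, 0 ≤ w j) (hc : 0 ≤ c) {δ : ℝ} (hδ0 : 0 < δ) (hδ1 : δ ≤ 1)
    {J : ℕ} (hmid : ∀ j, 1 ≤ j → j < J → w j ≤ 1 - δ) (hcJ : 2 * c * J ≤ δ) :
    tSeq w c init J ≤ 2 * (1 + aSeq w c init 1 / δ) := by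
  have ha1 : 0 ≤ aSeq w c init 1 := (aSeq_nonneg init hw hc 1).1
  have hcd : 0 ≤ c / δ := div_nonneg hc hδ0.le
  rcases Nat.eq_zero_or_pos J with rfl | hJ
  · rw [tSeq_zero]
    have : 0 ≤ aSeq w c init 1 / δ := div_nonneg ha1 hδ0.le
    linarith
  -- claim: `T_j ≤ 1 + a_1 + a_1 ((1-δ) - (1-δ)^j)/δ + (c/δ)(j-1) T_J` for `1 ≤ j ≤ J`
  have claim : ∀ j, 1 ≤ j → j ≤ J → tSeq w c init j ≤
      1 + aSeq w c init 1 + aSeq w c init 1 * ((1 - δ) - (1 - δ) ^ j) / δ +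
        c / δ * (j - 1 : ℝ) * tSeq w c init J := by
    intro j hj hjJ
    induction j with
    | zero => omega
    | succ j ih =>
      rcases Nat.eq_zero_or_pos j with rfl | hjpos
      · rw [tSeq_succ, tSeq_zero]
        simp
      · have ih' := ih hjpos (by omega)
        have ha := aSeq_le_middle init hw hc hδ0 hδ1 hmid (j + 1) (by omega) hjJ
        rw [Nat.add_sub_cancel] at ha
        have hT : tSeq w c init (j + 1) ≤ tSeq w c init J := tSeq_mono init hw hc hjJ
        have hcT : c / δ * tSeq w c init (j + 1) ≤ c / δ * tSeq w c init J :=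
          mul_le_mul_of_nonneg_left hT hcd
        rw [tSeq_succ]
        have e1 : ((j + 1 : ℕ) : ℝ) - 1 = ((j : ℕ) : ℝ) - 1 + 1 := by push_cast; ring
        have key : aSeq w c init 1 * ((1 - δ) - (1 - δ) ^ (j + 1)) / δ =
            aSeq w c init 1 * ((1 - δ) - (1 - δ) ^ j) / δ + aSeq w c init 1 * (1 - δ) ^ j := by
          rw [pow_succ]
          field_simp
          ring
        have e2 : c / δ * (((j : ℕ) : ℝ) - 1 + 1) * tSeq w c init J =
            c / δ * (((j : ℕ) : ℝ) - 1) * tSeq w c init J + c / δ * tSeq w c init J := by ring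
        rw [e1, key, e2]
        linarith
  have hJ' := claim J hJ le_rfl
  have hpow : 0 ≤ (1 - δ) ^ J := pow_nonneg (by linarith) J
  have hTJ : 0 ≤ tSeq w c init J := le_trans zero_le_one (one_le_tSeq init hw hc J)
  -- `(c/δ)(J-1) T_J ≤ T_J / 2`
  have hθ : c / δ * ((J : ℕ) - 1 : ℝ) ≤ 1 / 2 := by
    rw [div_mul_eq_mul_div, div_le_iff₀ hδ0]
    have : (0 : ℝ) ≤ J := Nat.cast_nonneg J
    nlinarith
  have h1 : c / δ * ((J : ℕ) - 1 : ℝ) * tSeq w c init J ≤ 1 / 2 * tSeq w c init J :=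
    mul_le_mul_of_nonneg_right hθ hTJ
  have h2 : aSeq w c init 1 * ((1 - δ) - (1 - δ) ^ J) / δ ≤ aSeq w c init 1 * (1 - δ) / δ := by
    rw [div_le_div_iff_of_pos_right hδ0]
    nlinarith
  have e : aSeq w c init 1 + aSeq w c init 1 * (1 - δ) / δ = aSeq w c init 1 / δ := by
    field_simp; ring
  linarith

/-- The total after `i` more steps is the old total plus the new agreeing masses. [folklore] -/
theorem tSeq_add (J i : ℕ) :
    tSeq w c init (J + i) = tSeq w c init J + ∑ i' ∈ range i, aSeq w c init (J + i' + 1) := by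
  induction i with
  | zero => simp
  | succ i ih => rw [← add_assoc, tSeq_succ, ih, sum_range_succ, add_assoc]

/-- **Tail phase** (the last `L` layers, `w_j ≤ 2`, cf. [KS, Lemma 9.5]: `D^{2 log n} ≤ n²`):
`a_{J+i} ≤ 2^i a_J + 2^{i+1} c i T_{J+L}`. [cite: KumarSaraf2017, Lemma 9.5] -/
theorem aSeq_le_tail (hw : ∀ j, 0 ≤ w j) (hc : 0 ≤ c) {J L : ℕ}
    (htail : ∀ j, J ≤ j → j < J + L → w j ≤ 2) :
    ∀ i, i ≤ L → aSeq w c init (J + i) ≤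
      2 ^ i * aSeq w c init J + 2 ^ (i + 1) * c * i * tSeq w c init (J + L) := by
  intro i hi
  induction i with
  | zero => simp
  | succ i ih =>
    have ih' := ih (Nat.le_of_succ_le hi)
    have hstep := aSeq_succ_le init hw hc (J + i)
    have hwi := htail (J + i) (Nat.le_add_right J i) (by omega)
    have hT : tSeq w c init (J + i) ≤ tSeq w c init (J + L) := tSeq_mono init hw hc (by omega)
    have hTn : 0 ≤ tSeq w c init (J + i) := le_trans zero_le_one (one_le_tSeq init hw hc _)
    have han : 0 ≤ aSeq w c init (J + i) := (aSeq_nonneg init hw hc _).1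
    have haJ : 0 ≤ aSeq w c init J := (aSeq_nonneg init hw hc _).1
    have hTL : 0 ≤ tSeq w c init (J + L) := le_trans zero_le_one (one_le_tSeq init hw hc _)
    rw [show J + (i + 1) = J + i + 1 by ring]
    have h2i : (0 : ℝ) ≤ 2 ^ i := pow_nonneg (by norm_num) i
    have h22 : (2 : ℝ) ≤ 2 ^ (i + 2) := by
      calc (2 : ℝ) = 2 ^ 1 := by norm_num
        _ ≤ 2 ^ (i + 2) := pow_le_pow_right₀ (by norm_num) (by omega)
    have hcT : 0 ≤ c * tSeq w c init (J + L) := mul_nonneg hc hTL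
    calc aSeq w c init (J + i + 1) ≤ w (J + i) * (aSeq w c init (J + i) + c * tSeq w c init (J + i)) :=
          hstep
      _ ≤ 2 * (aSeq w c init (J + i) + c * tSeq w c init (J + i)) :=
          mul_le_mul_of_nonneg_right hwi (by positivity)
      _ ≤ 2 * (2 ^ i * aSeq w c init J + 2 ^ (i + 1) * c * i * tSeq w c init (J + L) +
            c * tSeq w c init (J + L)) := by
          have : c * tSeq w c init (J + i) ≤ c * tSeq w c init (J + L) :=
            mul_le_mul_of_nonneg_left hT hc
          linarith
      _ = 2 ^ (i + 1) * aSeq w c init J + 2 ^ (i + 2) * c * i * tSeq w c init (J + L) +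
            2 * (c * tSeq w c init (J + L)) := by rw [pow_succ, pow_succ, pow_succ]; ring
      _ ≤ 2 ^ (i + 1) * aSeq w c init J + 2 ^ (i + 2) * c * i * tSeq w c init (J + L) +
            2 ^ (i + 2) * (c * tSeq w c init (J + L)) := by
          have := mul_le_mul_of_nonneg_right h22 hcT
          linarith
      _ = 2 ^ (i + 1) * aSeq w c init J + 2 ^ (i + 1 + 1) * c * ((i + 1 : ℕ) : ℝ) *
            tSeq w c init (J + L) := by push_cast; ring

/-- `∑_{i<L} 2^{i+1} ≤ 2^{L+1}` (in fact `= 2^{L+1} - 2`). [folklore] -/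
theorem sum_two_pow_succ_le (L : ℕ) : ∑ i ∈ range L, (2 : ℝ) ^ (i + 1) ≤ 2 ^ (L + 1) := by
  induction L with
  | zero => norm_num
  | succ L ih => rw [sum_range_succ, pow_succ (2 : ℝ) (L + 1)]; linarith

/-- **Tail phase, exact division form**: `T_{J+L} (1 - c L 2^{L+2}) ≤ T_J + 2^{L+1} a_J`.
[cite: KumarSaraf2017, Lemma 9.5] -/
theorem tSeq_tail_mul_le (hw : ∀ j, 0 ≤ w j) (hc : 0 ≤ c) {J L : ℕ}
    (htail : ∀ j, J ≤ j → j < J + L → w j ≤ 2) :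
    tSeq w c init (J + L) * (1 - c * L * 2 ^ (L + 2)) ≤
      tSeq w c init J + 2 ^ (L + 1) * aSeq w c init J := by
  have haJ : 0 ≤ aSeq w c init J := (aSeq_nonneg init hw hc _).1
  have hTL : 0 ≤ tSeq w c init (J + L) := le_trans zero_le_one (one_le_tSeq init hw hc _)
  have hL0 : (0 : ℝ) ≤ L := Nat.cast_nonneg L
  have hsum : ∑ i' ∈ range L, aSeq w c init (J + i' + 1) ≤
      ∑ i' ∈ range L, (2 ^ (i' + 1) * aSeq w c init J +
        2 ^ (i' + 1) * (2 * c * L * tSeq w c init (J + L))) := by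
    refine sum_le_sum fun i' hi' => ?_
    rw [mem_range] at hi'
    have h := aSeq_le_tail init hw hc htail (i' + 1) hi'
    rw [show J + (i' + 1) = J + i' + 1 by ring] at h
    refine h.trans ?_
    have h3 : ((i' + 1 : ℕ) : ℝ) ≤ L := by exact_mod_cast hi'
    have h2 : (0 : ℝ) ≤ 2 ^ (i' + 1) := pow_nonneg (by norm_num) _
    have h4 : 2 ^ (i' + 1 + 1) * c * ((i' + 1 : ℕ) : ℝ) * tSeq w c init (J + L) ≤
        2 ^ (i' + 1 + 1) * c * L * tSeq w c init (J + L) := by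
      apply mul_le_mul_of_nonneg_right _ hTL
      exact mul_le_mul_of_nonneg_left h3 (by positivity)
    have e : (2 : ℝ) ^ (i' + 1 + 1) * c * L * tSeq w c init (J + L) =
        2 ^ (i' + 1) * (2 * c * L * tSeq w c init (J + L)) := by rw [pow_succ]; ring
    linarith
  rw [sum_add_distrib, ← sum_mul, ← sum_mul] at hsum
  have hgeo := sum_two_pow_succ_le L
  have hg1 : (∑ i' ∈ range L, (2 : ℝ) ^ (i' + 1)) * aSeq w c init J ≤ 2 ^ (L + 1) * aSeq w c init J :=
    mul_le_mul_of_nonneg_right hgeo haJ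
  have hg2 : (∑ i' ∈ range L, (2 : ℝ) ^ (i' + 1)) * (2 * c * L * tSeq w c init (J + L)) ≤
      2 ^ (L + 1) * (2 * c * L * tSeq w c init (J + L)) :=
    mul_le_mul_of_nonneg_right hgeo (by positivity)
  have e := tSeq_add (w := w) (c := c) init J L
  have e2 : (2 : ℝ) ^ (L + 1) * (2 * c * L * tSeq w c init (J + L)) =
      c * L * 2 ^ (L + 2) * tSeq w c init (J + L) := by rw [pow_succ]; ring
  nlinarith

/-- **Tail phase, total**: with `c L 2^{L+2} ≤ 1/2`, `T_{J+L} ≤ 2 T_J + 2^{L+2} a_J`.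
[cite: KumarSaraf2017, Lemma 9.5] -/
theorem tSeq_le_tail (hw : ∀ j, 0 ≤ w j) (hc : 0 ≤ c) {J L : ℕ}
    (htail : ∀ j, J ≤ j → j < J + L → w j ≤ 2) (hcL : c * L * 2 ^ (L + 2) ≤ 1 / 2) :
    tSeq w c init (J + L) ≤ 2 * tSeq w c init J + 2 ^ (L + 2) * aSeq w c init J := by
  have h := tSeq_tail_mul_le init hw hc htail
  have hTL : 0 ≤ tSeq w c init (J + L) := le_trans zero_le_one (one_le_tSeq init hw hc _)
  have e2 : (2 : ℝ) ^ (L + 2) = 2 * 2 ^ (L + 1) := by rw [pow_succ]; ring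
  rw [e2]
  nlinarith [mul_le_mul_of_nonneg_right hcL hTL]

/-- **Same start** ([KS, Lemma 9.2 with Lemma 9.3]: `E[∑_γ D^{-Δ(β,γ)}] = O(1)` per block).
Degree profile hypotheses in the weights `w_j = D/deg_j`: `w_0 ≤ δ` (first layer of degree
`d₁ ≥ D/δ`), `w_j ≤ 1 - δ` for `1 ≤ j < J` (degree `2`, `D ≤ 2 - 2δ`), `w_j ≤ 2` on the tail
`J ≤ j < J + L` (degree `1`); smallness of `c = 1/ñ`: `2cJ ≤ δ`, `c L 2^{L+2} ≤ 1/2`,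
`2^{L+3} c ≤ δ`; and the tuning hypothesis `2^{L+2} w_0 (1-δ)^{J-1} ≤ κ` (the diagonal term
`D^{k'}/∏ deg`). Then `∑_{A ⊆ [J+L]} c^{#charged runs} ∏_{j∈A} w_j ≤ 12 + κ`.
[cite: KumarSaraf2017, Lemma 9.2] -/
theorem sum_runWeight_le_of_sameStart (hw : ∀ j, 0 ≤ w j) (hc : 0 ≤ c) {δ κ : ℝ} (hδ0 : 0 < δ)
    (hδ1 : δ ≤ 1) {J L : ℕ} (hJ : 1 ≤ J) (h0 : w 0 ≤ δ)
    (hmid : ∀ j, 1 ≤ j → j < J → w j ≤ 1 - δ) (htail : ∀ j, J ≤ j → j < J + L → w j ≤ 2)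
    (hcJ : 2 * c * J ≤ δ) (hcL : c * L * 2 ^ (L + 2) ≤ 1 / 2) (hcδ : 2 ^ (L + 3) * c ≤ δ)
    (hκ : 2 ^ (L + 2) * w 0 * (1 - δ) ^ (J - 1) ≤ κ) :
    ∑ A ∈ (range (J + L)).powerset, runWeight w c true A ≤ 12 + κ := by
  rw [sum_runWeight_eq]
  change tSeq w c true (J + L) ≤ 12 + κ
  have ha1 : aSeq w c true 1 = w 0 := by simp [aSeq_succ]
  have hmidT := tSeq_le_middle true hw hc hδ0 hδ1 hmid hcJ
  have haJ := aSeq_le_middle true hw hc hδ0 hδ1 hmid J hJ le_rfl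
  have htailT := tSeq_le_tail true hw hc htail hcL
  rw [ha1] at hmidT haJ
  have hTJ : 0 ≤ tSeq w c true J := le_trans zero_le_one (one_le_tSeq true hw hc J)
  have hw0d : w 0 / δ ≤ 1 := by rw [div_le_one hδ0]; exact h0
  have hpow : (0 : ℝ) ≤ 2 ^ (L + 2) := by positivity
  have hcd : 2 ^ (L + 2) * (c / δ) ≤ 1 / 2 := by
    rw [show (2 : ℝ) ^ (L + 3) = 2 ^ (L + 2) * 2 by rw [pow_succ]] at hcδ
    rw [← mul_div_assoc, div_le_iff₀ hδ0]
    linarith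
  have h1 : 2 ^ (L + 2) * aSeq w c true J ≤ κ + 1 / 2 * tSeq w c true J := by
    have h2 := mul_le_mul_of_nonneg_left haJ hpow
    have h3 : 2 ^ (L + 2) * (c / δ) * tSeq w c true J ≤ 1 / 2 * tSeq w c true J :=
      mul_le_mul_of_nonneg_right hcd hTJ
    have e : 2 ^ (L + 2) * (w 0 * (1 - δ) ^ (J - 1) + c / δ * tSeq w c true J) =
        2 ^ (L + 2) * w 0 * (1 - δ) ^ (J - 1) + 2 ^ (L + 2) * (c / δ) * tSeq w c true J := by ring
    linarith
  linarith

/-- **Different starts** ([KS, Lemma 9.4]: walks from different vertices agree somewhere only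
after an "agree switch", each costing `1/ñ`): with `w_0 = 0` (no agreement on the first layer:
different rows) and the middle/tail/smallness hypotheses of `sum_runWeight_le_of_sameStart`, the
total is `≤ 1 + η` with `η = 6 (cJ/δ + 2^{L+2} c/δ + c L 2^{L+2})` — the empty agreement set
contributes `1`. [cite: KumarSaraf2017, Lemma 9.4] -/
theorem sum_runWeight_le_of_diffStart (hw : ∀ j, 0 ≤ w j) (hc : 0 ≤ c) {δ : ℝ} (hδ0 : 0 < δ)
    (hδ1 : δ ≤ 1) {J L : ℕ} (hJ : 1 ≤ J) (h0 : w 0 = 0)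
    (hmid : ∀ j, 1 ≤ j → j < J → w j ≤ 1 - δ) (htail : ∀ j, J ≤ j → j < J + L → w j ≤ 2)
    (hcJ : 2 * c * J ≤ δ) (hcL : c * L * 2 ^ (L + 2) ≤ 1 / 2) (hcδ : 2 ^ (L + 3) * c ≤ δ) :
    ∑ A ∈ (range (J + L)).powerset, runWeight w c false A ≤
      1 + 6 * (c * J / δ + 2 ^ (L + 2) * c / δ + c * L * 2 ^ (L + 2)) := by
  rw [sum_runWeight_eq]
  change tSeq w c false (J + L) ≤ _
  have ha1 : aSeq w c false 1 = 0 := by simp [aSeq_succ, h0]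
  have hcd : 0 ≤ c / δ := div_nonneg hc hδ0.le
  have haJ := aSeq_le_middle false hw hc hδ0 hδ1 hmid J hJ le_rfl
  rw [ha1, zero_mul, zero_add] at haJ
  have hTJ0 : 0 ≤ tSeq w c false J := le_trans zero_le_one (one_le_tSeq false hw hc J)
  have hTL0 : 0 ≤ tSeq w c false (J + L) := le_trans zero_le_one (one_le_tSeq false hw hc _)
  -- middle with `a_1 = 0`: `T_j ≤ 1 + (c/δ)(j-1) T_J`
  have claim : ∀ j, 1 ≤ j → j ≤ J →
      tSeq w c false j ≤ 1 + c / δ * (j - 1 : ℝ) * tSeq w c false J := by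
    intro j hj hjJ
    induction j with
    | zero => omega
    | succ j ih =>
      rcases Nat.eq_zero_or_pos j with rfl | hjpos
      · rw [tSeq_succ, tSeq_zero, ha1]; simp
      · have ih' := ih hjpos (by omega)
        have ha := aSeq_le_middle false hw hc hδ0 hδ1 hmid (j + 1) (by omega) hjJ
        rw [ha1, zero_mul, zero_add] at ha
        have hT : tSeq w c false (j + 1) ≤ tSeq w c false J := tSeq_mono false hw hc hjJ
        have hcT : c / δ * tSeq w c false (j + 1) ≤ c / δ * tSeq w c false J :=
          mul_le_mul_of_nonneg_left hT hcd
        rw [tSeq_succ]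
        have e1 : ((j + 1 : ℕ) : ℝ) - 1 = ((j : ℕ) : ℝ) - 1 + 1 := by push_cast; ring
        have e2 : c / δ * (((j : ℕ) : ℝ) - 1 + 1) * tSeq w c false J =
            c / δ * (((j : ℕ) : ℝ) - 1) * tSeq w c false J + c / δ * tSeq w c false J := by ring
        rw [e1, e2]
        linarith
  have hmidT := claim J hJ le_rfl
  set θ₁ := c * J / δ with hθ₁
  set θ₂ := 2 ^ (L + 2) * c / δ with hθ₂
  set θ₃ := c * L * 2 ^ (L + 2) with hθ₃
  have hθ₁0 : 0 ≤ θ₁ := by rw [hθ₁]; positivity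
  have hθ₂0 : 0 ≤ θ₂ := by rw [hθ₂]; positivity
  have hθ₃0 : 0 ≤ θ₃ := by rw [hθ₃]; positivity
  have hθ₁le : θ₁ ≤ 1 / 2 := by rw [hθ₁, div_le_iff₀ hδ0]; linarith
  have hθ₂le : θ₂ ≤ 1 / 2 := by
    rw [hθ₂, div_le_iff₀ hδ0]
    rw [show (2 : ℝ) ^ (L + 3) = 2 ^ (L + 2) * 2 by rw [pow_succ]] at hcδ
    linarith
  have hθ₃le : θ₃ ≤ 1 / 2 := hcL
  -- `T_J (1 - θ₁) ≤ 1`, hence `T_J ≤ 1 + 2θ₁`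
  have hθ : c / δ * ((J : ℕ) - 1 : ℝ) ≤ θ₁ := by
    rw [hθ₁, div_mul_eq_mul_div, div_le_div_iff_of_pos_right hδ0]
    nlinarith
  have hTJ1 : tSeq w c false J * (1 - θ₁) ≤ 1 := by
    nlinarith [mul_le_mul_of_nonneg_right hθ hTJ0]
  have hTJ : tSeq w c false J ≤ 1 + 2 * θ₁ := by
    by_contra hlt
    push Not at hlt
    have h1θ : 0 < 1 - θ₁ := by linarith
    have := mul_lt_mul_of_pos_right hlt h1θ
    nlinarith
  -- tail: `T_end (1 - θ₃) ≤ T_J + 2^{L+1} a_J ≤ T_J (1 + θ₂/2)`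
  have hexact := tSeq_tail_mul_le false hw hc htail (J := J) (L := L)
  have hθ₂' : 2 ^ (L + 1) * aSeq w c false J ≤ θ₂ / 2 * tSeq w c false J := by
    have h1 : (2 : ℝ) ^ (L + 1) * aSeq w c false J ≤ 2 ^ (L + 1) * (c / δ * tSeq w c false J) :=
      mul_le_mul_of_nonneg_left haJ (by positivity)
    have e : (2 : ℝ) ^ (L + 1) * (c / δ * tSeq w c false J) = θ₂ / 2 * tSeq w c false J := by
      rw [hθ₂, show (2 : ℝ) ^ (L + 2) = 2 ^ (L + 1) * 2 by rw [pow_succ]]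
      ring
    linarith
  have hA : tSeq w c false (J + L) * (1 - θ₃) ≤ (1 + 2 * θ₁) * (1 + θ₂ / 2) := by
    calc tSeq w c false (J + L) * (1 - θ₃) ≤ tSeq w c false J + 2 ^ (L + 1) * aSeq w c false J :=
          hexact
      _ ≤ tSeq w c false J + θ₂ / 2 * tSeq w c false J := by linarith
      _ = tSeq w c false J * (1 + θ₂ / 2) := by ring
      _ ≤ (1 + 2 * θ₁) * (1 + θ₂ / 2) := mul_le_mul_of_nonneg_right hTJ (by positivity)
  -- divide by `1 - θ₃ ≥ 1/2`: `T_end ≤ (1 + 2θ₁)(1 + θ₂/2)(1 + 2θ₃)`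
  have h1θ₃ : 0 < 1 - θ₃ := by linarith
  have hB : tSeq w c false (J + L) ≤ (1 + 2 * θ₁) * (1 + θ₂ / 2) * (1 + 2 * θ₃) := by
    by_contra hlt
    push Not at hlt
    have := mul_lt_mul_of_pos_right hlt h1θ₃
    have hP : 0 ≤ (1 + 2 * θ₁) * (1 + θ₂ / 2) := by positivity
    nlinarith [mul_nonneg hP hθ₃0]
  -- expand: all `θ ≤ 1/2`
  nlinarith [mul_nonneg hθ₁0 hθ₂0, mul_nonneg hθ₁0 hθ₃0, mul_nonneg hθ₂0 hθ₃0,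
    mul_nonneg (mul_nonneg hθ₁0 hθ₂0) hθ₃0,
    mul_le_mul_of_nonneg_left hθ₂le hθ₁0, mul_le_mul_of_nonneg_left hθ₃le hθ₁0,
    mul_le_mul_of_nonneg_left hθ₃le hθ₂0,
    mul_le_mul_of_nonneg_left hθ₃le (mul_nonneg hθ₁0 hθ₂0)]

end Bounds

end Literature.Computability.AlgebraicComplexity.KumarSaraf
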